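import Summits.NavierStokesRegularity.NavierStokesRegularity.Theorems.TypeICertificateLadderTargetStrainCubeDepletion
import Summits.NavierStokesRegularity.NavierStokesRegularity.Theorems.TypeICertificateLadderTargetFlowwiseDepletionRung
import HarnessLib

/-!
# Crux `Target` = `TypeICertificateLadder.NoTypeIBlowup` (stmt-NavierStokesRegularity-1217), line
# `depletion-ladder`: RUNG TWO OF THE AMPLITUDE LADDER — no Type-I blow-up at dimensionless rate
# `C < 9/(√3+√6) ≈ 2.152`

`--supports stmt-NavierStokesRegularity-1217` (seventh and closing file of the seat's S1/RUNG-TWO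
series; consumer of the depletion constant `…StrainCubeDepletion.lean` and of the flow-wise rung glue
`…FlowwiseDepletionRung.lean`).

**Theorem (`hasSmoothExtensionPast_of_rate_lt`).** Let `u` be a classical solution of the unforced
Navier–Stokes system on `ℝ³ × [0,T)` (`ν, T > 0`), Leray–Hopf from its rapidly decaying datum, with
eventual dimensionless rate `√(T−t) ‖u(t,x)‖ ≤ C√ν`. If `(√3+√6)/9 · C < 1`, i.e.
`C < 9/(√3+√6) = 2.1523…`, then `u` extends smoothly past `T`.

**Corollary (`rungTwo`).** The rung `X_2` of the ladder — the line's `DepletionLadder.Rung 2`, the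
conjunction S1 ∧ S2 of the skeleton of record `Cruxes/Target/Lines/depletion_ladder.lean`
(`rungTwo_of_parts`) — VERBATIM after unfolding: no finite-energy classical solution from a rapidly
decaying datum blows up at `T` with collapse Reynolds number `√(T−t)‖u(t)‖_∞/√ν ≤ 2` near `T`.

Context. The kernel-checked reach of every `L^q`-vorticity budget is `C < √6 − √2 ≈ 1.035`
(`Theorems/RungReynoldsOne/Negative/BudgetCeiling.lean`); the best unconditional rung before this
file was `C < 1.0327` (`…FiveHalvesWindowRung.lean`); every explicit constant in print is `< 0.3`
(Leray 1934 (3.9); Cortissoz–Montero–Pinilla 2014; Chae–Wolf 2017 Rmk 1.4 — as recorded in the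
route file's `RungReynoldsOne` docstring). The new ingredient is the DEPLETION CONSTANT
`|∫⟪ω,Duω⟫| ≤ ((√3+√6)/9)‖u‖_∞‖ω‖₂‖∇ω‖₂` (Betchov–Miller `∫⟪ω,Duω⟫ = −4∫det S`, Miller's
`|4det S| ≤ (2√6/9)|S|³`, and the strain-cube interpolation `∫|S|³ ≤ ‖u‖_∞(½‖Δu‖₂‖S‖₂ + ‖S‖₂‖∇S‖₂)`),
fed into the flow-wise S2 glue `rung_of_flowwiseDepletion` (depleted enstrophy Grönwall
`Z ≲ (T−t)^{−κ²C²/2}` against the Leray/Tao `H¹` blow-up rate). With this rung in the tree the crux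
`Target` is EXACTLY the registered residual S3 `stub_descentToRungTwo` (`noTypeIBlowup_iff_rungTwo_and_descent`
in the skeleton), the declared open Type-I Liouville content.

WHAT THIS IS NOT: not the crux (the descent S3 above rung two is open); no Type II.

References: Leray 1934 §§19–20; Robinson–Rodrigo–Sadowski (2016) Lemma 8.16; T. Tao,
arXiv:1108.1165, Thm. 5.4; R. Betchov, J. Fluid Mech. 1 (1956); E. Miller, Arch. Ration. Mech.
Anal. 237 (2020), Prop. 4.8. [folklore]
-/

noncomputable section

open Set Filter Topology MeasureTheory
open scoped RealInnerProductSpace ENNReal NNReal Laplacian ContDiff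
open Literature.Analysis.FluidPDE

namespace Summit.NavierStokesRegularity.NavierStokesRegularity.Theorems.DepletionLadder.StrainCube

-- the problem directory repeats the summit name (`NavierStokesRegularity/NavierStokesRegularity`)
set_option linter.dupNamespace false

open Summit.NavierStokesRegularity.NavierStokesRegularity.Theorems.RungReynoldsOne
open Summit.NavierStokesRegularity.NavierStokesRegularity.Theorems.DepletionLadder

/-- **Stub S1 in the slice class**: there is `κ < 1/2` — namely `κ = (√3+√6)/9` — such that every
`C^∞` divergence-free `v : ℝ³ → ℝ³` with `|v| ≤ M`, bounded gradient and `D⁰v, D¹v, D²v ∈ L²`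
satisfies `|∫⟪curl v, Dv (curl v)⟫| ≤ κ · M · ‖curl v‖₂ · ‖∇ curl v‖₂`. [folklore] -/
theorem exists_depletion_lt_half_slice :
    ∃ κ : ℝ, κ < 1 / 2 ∧ ∀ (v : EuclideanSpace ℝ (Fin 3) → EuclideanSpace ℝ (Fin 3)) (M B : ℝ),
      ContDiff ℝ ∞ v → VectorCalculus.IsDivFree v → (∀ x, ‖v x‖ ≤ M) → (∀ x, ‖fderiv ℝ v x‖ ≤ B) →
      (∫⁻ x, ‖iteratedFDeriv ℝ 0 v x‖ₑ ^ 2 < ⊤) → (∫⁻ x, ‖iteratedFDeriv ℝ 1 v x‖ₑ ^ 2 < ⊤) →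
      (∫⁻ x, ‖iteratedFDeriv ℝ 2 v x‖ₑ ^ 2 < ⊤) →
      |∫ x, ⟪curl v x, fderiv ℝ v x (curl v x)⟫| ≤
        κ * M * Real.sqrt (∫ x, ‖curl v x‖ ^ 2) *
          Real.sqrt (∫ x, frobeniusNormSq (fderiv ℝ (curl v) x)) :=
  ⟨(Real.sqrt 3 + Real.sqrt 6) / 9, depletion_constant_lt_half,
    fun _ _ _ hv hdiv hM hB h0 h1 h2 => abs_integral_stretching_le_strainCube hv hdiv hM hB h0 h1 h2⟩

/-- **Rungs below `9/(√3+√6)`.** A classical solution of the unforced Navier–Stokes system on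
`ℝ³ × [0,T)` (`ν, T > 0`), Leray–Hopf from its rapidly decaying datum, with eventual dimensionless
rate `√(T−t)‖u(t,x)‖ ≤ C√ν` and `((√3+√6)/9)·C < 1`, extends smoothly past `T`. Proof: on every
slice `t ∈ [0,T)` the Tao cover supplies the slice class (`stub_taoCover`, `HasBoundedSobolevNormsOn`,
`exists_forall_norm_fderiv_le_of_hasBoundedSobolevNormsOn`), the depletion constant
`abs_integral_stretching_le_strainCube` gives the flow-wise depletion bound, and
`rung_of_flowwiseDepletion` concludes. [folklore] -/
theorem hasSmoothExtensionPast_of_rate_lt {ν T C : ℝ} (hν : 0 < ν) (hT : 0 < T) (hC : 0 < C)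
    (hκC : (Real.sqrt 3 + Real.sqrt 6) / 9 * C < 1)
    {u : ℝ → EuclideanSpace ℝ (Fin 3) → EuclideanSpace ℝ (Fin 3)}
    {p : ℝ → EuclideanSpace ℝ (Fin 3) → ℝ}
    (hsol : IsClassicalNSSolutionOn (Ico 0 T) ν 0 u p) (hLH : IsLerayHopfOn T ν 0 (u 0) u)
    (hdec : HasRapidSpatialDecay (u 0))
    (hrate : ∀ᶠ t in 𝓝[<] T, ∀ x, Real.sqrt (T - t) * ‖u t x‖ ≤ C * Real.sqrt ν) :
    HasSmoothExtensionPast ν 0 u T := by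
  have hκ0 : 0 ≤ (Real.sqrt 3 + Real.sqrt 6) / 9 := by positivity
  refine rung_of_flowwiseDepletion hν hT hκ0 hC hκC hsol hLH hdec (fun t ht M hM => ?_) hrate
  -- the slice class at time `t`, from a Tao-class slab `[0, (t+T)/2]`
  have ht' : (t + T) / 2 ∈ Ioo 0 T := ⟨by linarith [ht.1], by linarith [ht.2]⟩
  obtain ⟨q, hsolt, hut, -, -⟩ := stub_taoCover hν hT hsol hLH hdec ht'
  have htI : t ∈ Icc 0 ((t + T) / 2) := ⟨ht.1, by linarith [ht.2]⟩
  obtain ⟨C₀, hC₀⟩ := hut 0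
  obtain ⟨C₁, hC₁⟩ := hut 1
  obtain ⟨C₂, hC₂⟩ := hut 2
  obtain ⟨B₁, -, hB₁⟩ := exists_forall_norm_fderiv_le_of_hasBoundedSobolevNormsOn
    (fun s hs => (hsolt.contDiff_velocity hs).of_le (by norm_cast)) hut
  have h0 : ∫⁻ x, ‖iteratedFDeriv ℝ 0 (u t) x‖ₑ ^ 2 < ⊤ := (hC₀ t htI).trans_lt ENNReal.coe_lt_top
  have h1 : ∫⁻ x, ‖iteratedFDeriv ℝ 1 (u t) x‖ₑ ^ 2 < ⊤ := (hC₁ t htI).trans_lt ENNReal.coe_lt_top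
  have h2 : ∫⁻ x, ‖iteratedFDeriv ℝ 2 (u t) x‖ₑ ^ 2 < ⊤ := (hC₂ t htI).trans_lt ENNReal.coe_lt_top
  have hv : ContDiff ℝ ∞ (u t) := hsol.contDiff_velocity ht
  have hdiv : VectorCalculus.IsDivFree (u t) := hsol.divFree t ht
  exact abs_integral_stretching_le_strainCube hv hdiv hM (hB₁ t htI) h0 h1 h2

/-- **RUNG TWO (`X_2`) — `DepletionLadder.Rung 2` of the skeleton of record, VERBATIM after
unfolding.** Every classical solution of the unforced Navier–Stokes system on `ℝ³ × [0,T)`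
(`ν, T > 0`), Leray–Hopf from its rapidly decaying datum, whose dimensionless rate is eventually
at most `2`, `√(T−t)‖u(t,x)‖ ≤ 2√ν`, extends smoothly past `T` (`((√3+√6)/9)·2 < 1`). [folklore] -/
theorem rungTwo :
    ∀ (ν T : ℝ), 0 < ν → 0 < T →
      ∀ (u : ℝ → EuclideanSpace ℝ (Fin 3) → EuclideanSpace ℝ (Fin 3))
        (p : ℝ → EuclideanSpace ℝ (Fin 3) → ℝ),
        IsClassicalNSSolutionOn (Set.Ico 0 T) ν 0 u p → IsLerayHopfOn T ν 0 (u 0) u →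
        HasRapidSpatialDecay (u 0) →
        (∀ᶠ t in 𝓝[<] T, ∀ x, Real.sqrt (T - t) * ‖u t x‖ ≤ 2 * Real.sqrt ν) →
        HasSmoothExtensionPast ν 0 u T := by
  intro ν T hν hT u p hsol hLH hdec hrate
  have h2 : (Real.sqrt 3 + Real.sqrt 6) / 9 * 2 < 1 := by
    have := depletion_constant_lt_half; linarith
  exact hasSmoothExtensionPast_of_rate_lt hν hT (by norm_num) h2 hsol hLH hdec hrate

/-- **All rungs up to `2.15`**: for every `0 < C ≤ 2.15` the rung `X_C` holds
(`(√3+√6)/9 · 2.15 < 1` since `√3 < 1.7321`, `√6 < 2.4495`). [folklore] -/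
theorem rung_of_le {C : ℝ} (hC : 0 < C) (hC' : C ≤ 2.15) :
    ∀ (ν T : ℝ), 0 < ν → 0 < T →
      ∀ (u : ℝ → EuclideanSpace ℝ (Fin 3) → EuclideanSpace ℝ (Fin 3))
        (p : ℝ → EuclideanSpace ℝ (Fin 3) → ℝ),
        IsClassicalNSSolutionOn (Set.Ico 0 T) ν 0 u p → IsLerayHopfOn T ν 0 (u 0) u →
        HasRapidSpatialDecay (u 0) →
        (∀ᶠ t in 𝓝[<] T, ∀ x, Real.sqrt (T - t) * ‖u t x‖ ≤ C * Real.sqrt ν) →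
        HasSmoothExtensionPast ν 0 u T := by
  intro ν T hν hT u p hsol hLH hdec hrate
  have h3 : Real.sqrt 3 < 1.7321 := by
    rw [Real.sqrt_lt' (by norm_num)]; norm_num
  have h6 : Real.sqrt 6 < 2.4495 := by
    rw [Real.sqrt_lt' (by norm_num)]; norm_num
  have hκC : (Real.sqrt 3 + Real.sqrt 6) / 9 * C < 1 := by
    have h0 : 0 ≤ Real.sqrt 3 + Real.sqrt 6 := by positivity
    nlinarith
  exact hasSmoothExtensionPast_of_rate_lt hν hT hC hκC hsol hLH hdec hrate

end Summit.NavierStokesRegularity.NavierStokesRegularity.Theorems.DepletionLadder.StrainCube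

end
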